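import Summits.BirchSwinnertonDyer.BirchSwinnertonDyer.Theorems.EisensteinPrimesGoodLatticeKatzMeasureUniqueness
import Literature.NumberTheory.EllipticCurves.DeShalit1987.KatzPAdicLFunctionFunctionalEquation
import Summits.BirchSwinnertonDyer.BirchSwinnertonDyer.Theorems.PrintCf2RubinValueTwoKatzPeriodRigidityFull
import Summits.BirchSwinnertonDyer.BirchSwinnertonDyer.Theorems.PrintCf2RubinValueTwoRubinValueFormulaAtTwoUniqueTransport
import HarnessLib

set_option linter.dupNamespace false
set_option autoImplicit false

/-!
# UNIQUENESS OF THE TWO-VARIABLE KATZ–DE SHALIT FRAME `IsKatzMeasure₂` AT FIXED DATA, IN THE BINDER GENERALITY OF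
# `DeShalit1987.thmII64_katzMeasure₂_functionalEquation` — every imaginary quadratic `K`, EVERY split `p`, twist of ANY
# integer infinity type (incl. the reflected twist `λ̌`), UNIT generator pairs — the functional equation in the
# ∀G∀Ǧ∃(C,g)-form / from an ∃-form at fixed data, and seedless unit-pair PERIOD rigidity

Cell `bsd-eis` (run/shared/lean/pub/bsd-eis/), width seat `bsd-line-x1-p1-w2` gen 32; `--supports stmt-BirchSwinnertonDyer-19032`
(crux 2 `GoodLatticeBDPValue`, line `halves` v34N; helper, closes nothing by itself).  THEOREMS ONLY (no `def`, no named
fact, no `sorry`).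

WHY.  After width gen 31 (p767199 / p767732 / p768107 / p768473) six of the seven PUBLISHED names behind the crux are
∃-shaped on the period axis or carry a kernel «∀ ⟸ ∃» certificate; the one residual is de Shalit II.6.4,
`DeShalit1987.thmII64_katzMeasure₂_functionalEquation`, typed as «for ANY `G` with `IsKatzMeasure₂ … λ … G` there are `Ǧ`,
a unit `C` and `g` with `G(P(r)) = C·r(g)·Ǧ(P(r₂))`», universally over period triples and UNIT generator pairs, for a
twist `λ` that is merely ALGEBRAIC (any infinity type) — while print speaks of THE measures `μ(𝔣𝔭̄^∞)`, `μ(𝔣̄𝔭̄^∞)`.  Its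
docstring (R4) says the ∀-frame phrasing "says no more than print" because the typed interpolation range pins `G`,
"nothing about frame rigidity is asserted as a separate statement".  The tree's uniqueness theorem
`CycTangentCMKatzFrameUniqueness.isKatzMeasure₂_unique` covers only: a type-`(w₀,0)` seed character ON `K` as a
HYPOTHESIS (available in Literature at class number one when it was written), `λ` of type `(−a, b)` with `b ≤ a`
(natural numbers — so NOT the reflected twist `reflect θ_K⁻¹ = θ_K‖·‖` of type `(−1,−1)`, nor any `λ̌` off that cone),
and TOPOLOGICAL generator pairs (`κ_i(γ_i) = 1` exactly — not the fact's `IsUnitGeneratorPair`, nor Rubin's inverse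
generators) — and `p ≠ 2`.  This file removes all four restrictions:

* §1 `isKatzMeasure₂_unique_of_hasInfinityType` — `K` imaginary quadratic (ANY class number: the seed is now the tree's
  `HeckeCharacter.exists_hasInfinityType_pos_zero_unramified`, type `(h_K·w_K, 0)`), ANY split `p`, `λ` of ANY constant
  integer type `(k, j)`, unramified off `S ∪ {v̄}`, top generator pair, any `(Ω, δ, Ω_p)`: two frames are EQUAL.  Proof =
  the p594805-lineage proof with the auxiliary exponent `N ≥ |k| + |j| + 1` (so every supply character
  `λ·Ψ₁^{W a_s p^e}·(Ψ₁^{W p^e}∘c)⁻¹` has type `(−m, j')`, `0 ≤ j' < m`, whatever the signs of `k, j`).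
* §2 `exists_isTopGeneratorPair_unitTwist`, `isKatzMeasure₂_unique_of_isUnitGeneratorPair` — the frame does not see unit
  twists `u•κ_i` of the coordinates (the tree's `PrintCf2.KatzUniqueTransport.isKatzMeasure₂_unitTwist_iff`, same kernels),
  and a unit generator pair is a topological one for `(u₁⁻¹•κ₁, u₂⁻¹•κ₂)`: uniqueness for `IsUnitGeneratorPair`.
* §3 `isKatzMeasure₂_unique_of_isAlgebraic` (the fact's `λ`-binders verbatim: algebraic, unramified off `S ∪ {v̄}`, unit
  pair) and `isKatzMeasure₂_reflect_unique` (the fact's CONCLUSION frame: `reflect λ` at `c • S`; `λ̌` has type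
  `(−j−1, −k−1)` and `𝔣_λ̌ = 𝔣̄_λ`).
* §4 `thmII64_relation_of_reflectFrame` — typed (∀G ∃Ǧ) ⟹ (∀G ∀Ǧ ∃(C,g)): granted the fact, the relation holds against
  ANY reflected frame, not only the produced one; `thmII64_conclusion_of_exists_frame_at_fixed_data` — (∃G₀ Ǧ C g at the
  data) ⟹ the fact's conclusion for EVERY `G` at the same data.  At fixed `(ι, v, v̄, S, λ, κ₁, κ₂, γ₁, γ₂, Ω, δ, Ω_p)` the
  ∀-frame phrasing of II.6.4 is therefore a statement about THE pair of measures, exactly as de Shalit's own proof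
  ("there are enough admissible `ε_G` to separate points in `𝐃[[G]]`", p. 85).
* §5 `exists_eq_unit_binomPow₂_mul_of_isUnitGeneratorPair`, `span_eq_span_of_isKatzMeasure₂_of_isUnitGeneratorPair` — the
  tree's FULL two-variable PERIOD rigidity (`PrintCf2.KatzPeriodRigidity`, `λ` of type `(−a,b)`, `b ≤ a`) made seedless (every
  class number) and stated for UNIT generator pairs: the `λ`-side of the period axis for the cell's `λ = θ_K⁻¹` at Rubin's
  inverse generators.  NOT transported here: the period triple for the REFLECTED branch (type `(−j−1,−k−1)`, outside `b ≤ a`: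
  the B18 chain is written with ℕ-exponent algebra `A^{a+b}B^b`) together with the EXISTENCE of a `λ̌`-frame at a
  non-admissible period triple carrying a `λ`-frame, and the generator pair (a `GL₂(ℤ_p)` change of variables; print-faithful
  outright, "fix an isomorphism `κ_i`") — recorded as the remaining «exotic normalisation» residual of the typed II.6.4.

`p = 2` (allowed by print: "`1 + 4ℤ₂` if `p = 2`", II.4.17) is INSIDE every theorem here (file 1 runs the every-`p` split-prime
line `PrintCf2.SplitPrimeLine.exists_splitPrimeLine_factorsThroughZp_of_split`), so the fact's `∀ p` is covered at fixed data.  HONEST FRAMING: helper theorems about a characterising predicate; nothing here proves a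
summit statement, the crux, a stub, BSD, or a theorem of de Shalit / Katz / Rubin; 0 cells / labels / tiers move.

References: [deShalit1987] II.1.1, II.4.12 Remark (iv), II.4.16 (49)–(50), II.4.17 (51)–(54) (store chunk 77–78), II.6.1
(1)–(2) (store chunk 81), II.6.4 Theorem (i) and proof (store chunk 84–85); [Katz1978] (5.3.0); [Washington1997] §13.
-/

noncomputable section

open scoped NumberField Classical Topology
open Filter NumberField IsDedekindDomain Field
open Literature Literature.NumberTheory.GaloisRepresentations Literature.NumberTheory.EllipticCurves
open Summit.BirchSwinnertonDyer.Rank1Residual.X11b Summit.BirchSwinnertonDyer.Rank1Residual.X11b.LambdaSupply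
open Summit.BirchSwinnertonDyer.Rank1Residual.X11b.Three.LambdaSupply
open Summit.BirchSwinnertonDyer.BirchSwinnertonDyer.Theorems.CycTangentCMCycTangentBoundUniquenessLines
open Summit.BirchSwinnertonDyer.BirchSwinnertonDyer.Theorems.CycTangentCMCycTangentBoundInterpolationContinuation
open Summit.BirchSwinnertonDyer.BirchSwinnertonDyer.Theorems.CycTangentCMCycTangentBoundFrameUniqueness
open Summit.BirchSwinnertonDyer.BirchSwinnertonDyer.Theorems.CycTangentCMCycTangentBoundFrameUniquenessCM
open Literature.NumberTheory.EllipticCurves.DeShalit1987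

namespace Summit.BirchSwinnertonDyer.BirchSwinnertonDyer.Theorems.GoodLatticeKatzMeasureUniquenessBinders

open Summit.BirchSwinnertonDyer.BirchSwinnertonDyer.Theorems.GoodLatticeKatzMeasureUniqueness

variable {p : ℕ} [Fact p.Prime] {K : Type} [Field K] [NumberField K]

/-! ### §2 Unit generator pairs (de Shalit's coordinates "up to `ℤ_pˣ`", II.4.17) -/

omit [NumberField K] in
/-- **A unit generator pair becomes a topological generator pair after unit twists of the coordinates**:
`κ₁(γ₁) = u₁`, `κ₂(γ₂) = u₂` units ⟹ `(u₁⁻¹•κ₁)(γ₁) = 1 = (u₂⁻¹•κ₂)(γ₂)`, kernels unchanged.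
[cite: deShalit1987, II.4.17 (51)–(54) (store chunk 77–78)] -/
theorem exists_isTopGeneratorPair_unitTwist {κ₁ κ₂ : ZpExtension K p} {γ₁ γ₂ : absoluteGaloisGroup K}
    (h : ZpExtension.IsUnitGeneratorPair κ₁ κ₂ γ₁ γ₂) :
    ∃ u₁ u₂ : ℤ_[p]ˣ, ZpExtension.IsTopGeneratorPair (κ₁.unitTwist u₁) (κ₂.unitTwist u₂) γ₁ γ₂ := by
  obtain ⟨hu₁, hγ₁, hγ₂, hu₂⟩ := h
  refine ⟨hu₁.unit⁻¹, hu₂.unit⁻¹, ?_, ?_, ?_, ?_⟩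
  · show κ₁.unitTwist _ γ₁ = Multiplicative.ofAdd 1
    rw [ZpExtension.unitTwist_apply, IsUnit.val_inv_mul]
  · rw [ZpExtension.kerSubgroup_unitTwist]
    exact hγ₁
  · rw [ZpExtension.kerSubgroup_unitTwist]
    exact hγ₂
  · show κ₂.unitTwist _ γ₂ = Multiplicative.ofAdd 1
    rw [ZpExtension.unitTwist_apply, IsUnit.val_inv_mul]

/-- **UNIQUENESS AT FIXED DATA FOR UNIT GENERATOR PAIRS** (the coordinates of
`DeShalit1987.thmII64_katzMeasure₂_functionalEquation` and of Rubin's frame at the INVERSE generators):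
as `isKatzMeasure₂_unique_of_hasInfinityType`, for `ZpExtension.IsUnitGeneratorPair`.
[cite: deShalit1987, II.4.17 (51)–(54) (store chunk 77–78), II.6.4 proof (store chunk 85)] -/
theorem isKatzMeasure₂_unique_of_isUnitGeneratorPair (hK : IsImaginaryQuadratic K)
    {ι : PadicAlgCl p ≃+* ℂ} {v vbar : HeightOneSpectrum (𝓞 K)}
    (hv : ((p : ℕ) : 𝓞 K) ∈ v.asIdeal) (hvbar : ((p : ℕ) : 𝓞 K) ∈ vbar.asIdeal) (hne : vbar ≠ v)
    (hι : ∀ (w : InfinitePlace K) (d : 𝓞 K), d ∈ v.asIdeal ↔ ‖ι.symm (w.embedding (d : K))‖ < 1)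
    {S : Finset (HeightOneSpectrum (𝓞 K))}
    {lam : HeckeCharacter K} {kl jl : ℤ}
    (hlam : lam.HasInfinityType (fun _ ↦ kl) (fun _ ↦ jl))
    (hlamu : ∀ w : HeightOneSpectrum (𝓞 K), w ∉ S → w ≠ vbar → lam.IsUnramifiedAt w)
    {κ₁ κ₂ : ZpExtension K p} {γ₁ γ₂ : absoluteGaloisGroup K}
    (hpair : ZpExtension.IsUnitGeneratorPair κ₁ κ₂ γ₁ γ₂)
    {Ω δ : ℂ} {Ωp : ℂ_[p]} {G G' : PowerSeries (PowerSeries (PadicComplexInt p))}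
    (hG : IsKatzMeasure₂ ι v vbar S κ₁ κ₂ γ₁ γ₂ lam Ω δ Ωp G)
    (hG' : IsKatzMeasure₂ ι v vbar S κ₁ κ₂ γ₁ γ₂ lam Ω δ Ωp G') : G = G' := by
  obtain ⟨u₁, u₂, htop⟩ := exists_isTopGeneratorPair_unitTwist hpair
  exact isKatzMeasure₂_unique_of_hasInfinityType hK hv hvbar hne hι hlam hlamu htop
    ((PrintCf2.KatzUniqueTransport.isKatzMeasure₂_unitTwist_iff κ₁ κ₂ u₁ u₂).mpr hG) ((PrintCf2.KatzUniqueTransport.isKatzMeasure₂_unitTwist_iff κ₁ κ₂ u₁ u₂).mpr hG')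

/-! ### §3 The binders of `thmII64_katzMeasure₂_functionalEquation`: `λ` algebraic, and the reflected twist -/

/-- An imaginary quadratic field has exactly one infinite place, so an infinity type is a CONSTANT pair
`(k, j) ∈ ℤ²`: an algebraic `λ` has `λ.HasInfinityType (fun _ ↦ k) (fun _ ↦ j)` for some integers `k, j`.
[cite: deShalit1987, II.1.1 (store chunk 32)] -/
theorem exists_hasInfinityType_const (hK : IsImaginaryQuadratic K) {lam : HeckeCharacter K}
    (hlam : lam.IsAlgebraic) : ∃ k j : ℤ, lam.HasInfinityType (fun _ ↦ k) (fun _ ↦ j) := by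
  haveI : IsTotallyComplex K := hK.2
  obtain ⟨kf, jf, hkj⟩ := (HeckeCharacter.isAlgebraic_iff_exists_hasInfinityType lam).mp hlam
  have hcard : Fintype.card (InfinitePlace K) = 1 := by
    have h1 := IsTotallyComplex.finrank (K := K)
    have h2 := NumberField.InfinitePlace.card_eq_nrRealPlaces_add_nrComplexPlaces (K := K)
    rw [IsTotallyComplex.nrRealPlaces_eq_zero, zero_add] at h2
    have h3 := hK.1
    omega
  obtain ⟨w₀, -⟩ := Fintype.card_eq_one_iff.mp hcard
  haveI : Subsingleton (InfinitePlace K) := Fintype.card_le_one_iff_subsingleton.mp hcard.le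
  have ek : kf = fun _ ↦ kf w₀ := funext fun w ↦ congrArg kf (Subsingleton.elim w w₀)
  have ej : jf = fun _ ↦ jf w₀ := funext fun w ↦ congrArg jf (Subsingleton.elim w w₀)
  rw [ek, ej] at hkj
  exact ⟨kf w₀, jf w₀, hkj⟩

/-- **UNIQUENESS OF THE `λ`-FRAME IN THE BINDERS OF `thmII64_katzMeasure₂_functionalEquation`** (`λ`
merely ALGEBRAIC, unramified at every `w ∉ S ∪ {v̄}`; unit generator pair; any period data), every split `p`:
the "ANY `G` with `IsKatzMeasure₂ … λ … G`" of the named fact is THE `G` — at fixed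
`(ι, v, v̄, S, κ₁, κ₂, γ₁, γ₂, λ, Ω, δ, Ω_p)` the frame has at most one witness. This is the kernel form of
the fact's docstring remark "(R4) … frame rigidity is NOT asserted separately" at fixed data, and of de Shalit's
"there are enough admissible `ε_G` to separate points in `𝐃[[G]]`".
[cite: deShalit1987, II.6.4 Theorem (i) and proof (store chunk 84–85), II.4.17 (54) (store chunk 78)] -/
theorem isKatzMeasure₂_unique_of_isAlgebraic (hK : IsImaginaryQuadratic K)
    {ι : PadicAlgCl p ≃+* ℂ} {v vbar : HeightOneSpectrum (𝓞 K)}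
    (hv : ((p : ℕ) : 𝓞 K) ∈ v.asIdeal) (hvbar : ((p : ℕ) : 𝓞 K) ∈ vbar.asIdeal) (hne : vbar ≠ v)
    (hι : ∀ (w : InfinitePlace K) (d : 𝓞 K), d ∈ v.asIdeal ↔ ‖ι.symm (w.embedding (d : K))‖ < 1)
    {S : Finset (HeightOneSpectrum (𝓞 K))}
    {lam : HeckeCharacter K} (hlam : lam.IsAlgebraic)
    (hlamu : ∀ w : HeightOneSpectrum (𝓞 K), w ∉ S → w ≠ vbar → lam.IsUnramifiedAt w)
    {κ₁ κ₂ : ZpExtension K p} {γ₁ γ₂ : absoluteGaloisGroup K}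
    (hpair : ZpExtension.IsUnitGeneratorPair κ₁ κ₂ γ₁ γ₂)
    {Ω δ : ℂ} {Ωp : ℂ_[p]} {G G' : PowerSeries (PowerSeries (PadicComplexInt p))}
    (hG : IsKatzMeasure₂ ι v vbar S κ₁ κ₂ γ₁ γ₂ lam Ω δ Ωp G)
    (hG' : IsKatzMeasure₂ ι v vbar S κ₁ κ₂ γ₁ γ₂ lam Ω δ Ωp G') : G = G' := by
  obtain ⟨kl, jl, hkj⟩ := exists_hasInfinityType_const hK hlam
  exact isKatzMeasure₂_unique_of_isUnitGeneratorPair hK hv hvbar hne hι hkj hlamu hpair hG hG'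

/-- `w ∉ c • S ⟹ c • w ∉ S` (`c² = 1` on the finite places). [cite: deShalit1987, II.6.1 ("`𝔣_ε̌ = 𝔣̄_ε`", store chunk 81)] -/
theorem complexConj_smul_not_mem_of_not_mem_image [IsCMField K] {S : Finset (HeightOneSpectrum (𝓞 K))}
    {w : HeightOneSpectrum (𝓞 K)} (hw : w ∉ S.image fun w ↦ IsCMField.complexConj K • w) :
    IsCMField.complexConj K • w ∉ S := by
  intro h
  apply hw
  have hcc : IsCMField.complexConj K * IsCMField.complexConj K = 1 := by
    rw [← pow_two, ← IsCMField.orderOf_complexConj K, pow_orderOf_eq_one]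
  exact Finset.mem_image.mpr ⟨_, h, by rw [smul_smul, hcc, one_smul]⟩

/-- **UNIQUENESS OF THE REFLECTED FRAME `Ǧ`** — the `∃ Gc` of `thmII64_katzMeasure₂_functionalEquation` is
THE `λ̌`-branch: in the fact's binders (`λ` algebraic, unramified at every `w ∉ S` — the fact assumes it at `v`,
`v̄` and off `S ∪ {v, v̄}`), every split `p`, two witnesses of
`IsKatzMeasure₂ ι v v̄ (c • S) κ₁ κ₂ γ₁ γ₂ (reflect λ) Ω δ Ω_p` are equal (`reflect λ` is algebraic of type
`(−j−1, −k−1)`, `hasInfinityType_reflect`, and unramified off `c • S`, `isUnramifiedAt_reflect_iff`).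
[cite: deShalit1987, II.6.1 (1) (store chunk 81), II.6.4 Theorem (i) (store chunk 84)] -/
theorem isKatzMeasure₂_reflect_unique [IsCMField K] (hK : IsImaginaryQuadratic K)
    {ι : PadicAlgCl p ≃+* ℂ} {v vbar : HeightOneSpectrum (𝓞 K)}
    (hv : ((p : ℕ) : 𝓞 K) ∈ v.asIdeal) (hvbar : ((p : ℕ) : 𝓞 K) ∈ vbar.asIdeal) (hne : vbar ≠ v)
    (hι : ∀ (w : InfinitePlace K) (d : 𝓞 K), d ∈ v.asIdeal ↔ ‖ι.symm (w.embedding (d : K))‖ < 1)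
    {S : Finset (HeightOneSpectrum (𝓞 K))}
    {lam : HeckeCharacter K} (hlam : lam.IsAlgebraic)
    (hlamS : ∀ w : HeightOneSpectrum (𝓞 K), w ∉ S → lam.IsUnramifiedAt w)
    {κ₁ κ₂ : ZpExtension K p} {γ₁ γ₂ : absoluteGaloisGroup K}
    (hpair : ZpExtension.IsUnitGeneratorPair κ₁ κ₂ γ₁ γ₂)
    {Ω δ : ℂ} {Ωp : ℂ_[p]} {Gc Gc' : PowerSeries (PowerSeries (PadicComplexInt p))}
    (hGc : IsKatzMeasure₂ ι v vbar (S.image fun w ↦ IsCMField.complexConj K • w) κ₁ κ₂ γ₁ γ₂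
      (reflect lam) Ω δ Ωp Gc)
    (hGc' : IsKatzMeasure₂ ι v vbar (S.image fun w ↦ IsCMField.complexConj K • w) κ₁ κ₂ γ₁ γ₂
      (reflect lam) Ω δ Ωp Gc') : Gc = Gc' := by
  obtain ⟨kl, jl, hkj⟩ := exists_hasInfinityType_const hK hlam
  have hrt := hasInfinityType_reflect hkj
  have hru : ∀ w : HeightOneSpectrum (𝓞 K), w ∉ (S.image fun w ↦ IsCMField.complexConj K • w) →
      w ≠ vbar → (reflect lam).IsUnramifiedAt w :=
    fun w hw _ ↦ (isUnramifiedAt_reflect_iff lam w).mpr (hlamS _ (complexConj_smul_not_mem_of_not_mem_image hw))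
  exact isKatzMeasure₂_unique_of_isUnitGeneratorPair hK hv hvbar hne hι hrt hru hpair hGc hGc'

/-! ### §4 The functional equation in the ∀G∀Ǧ∃(C,g)-form and from an ∃-form at FIXED data (every `p`) -/

/-- **Typed (∀G ∃Ǧ) ⟹ (∀G ∀Ǧ ∃(C, g)).** Granted the named fact, for ANY reflected frame `Ǧ'`
(not only the one the fact produces) there are a `p`-adic unit `C` and `g ∈ Γ_K` with
"`G(P(r)) = C·r(g)·Ǧ'(P(r₂))`" for all conjugate-inverse pairs `(r, r₂)` through the tower — because `Ǧ' = Ǧ`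
(`isKatzMeasure₂_reflect_unique`). With `isKatzMeasure₂_unique_of_isAlgebraic` this says: at fixed data the
typed ∀-frame fact is a statement about THE pair of measures `(μ(𝔣𝔭̄^∞), μ(𝔣̄𝔭̄^∞))`, as in print.
[cite: deShalit1987, II.6.4 Theorem (i) (9), (14)–(15) (store chunk 84–85)] -/
theorem thmII64_relation_of_reflectFrame (hF : thmII64_katzMeasure₂_functionalEquation) [IsCMField K]
    (hK : IsImaginaryQuadratic K)
    {ι : PadicAlgCl p ≃+* ℂ} {v vbar : HeightOneSpectrum (𝓞 K)}
    (hv : ((p : ℕ) : 𝓞 K) ∈ v.asIdeal) (hvbar : ((p : ℕ) : 𝓞 K) ∈ vbar.asIdeal) (hne : vbar ≠ v)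
    (hι : ∀ (w : InfinitePlace K) (k : 𝓞 K), k ∈ v.asIdeal ↔ ‖ι.symm (w.embedding (k : K))‖ < 1)
    {Ω δ : ℂ} {Ωp : (unrIntegers p)ˣ} (hΩ : Ω ≠ 0)
    (hδ : δ ^ 2 = (NumberField.discr K : ℂ) ∨ δ ^ 2 = -(NumberField.discr K : ℂ))
    {S : Finset (HeightOneSpectrum (𝓞 K))} (hvS : v ∉ S) (hvbS : vbar ∉ S)
    {lam : HeckeCharacter K} (hlam : lam.IsAlgebraic) (hlamv : lam.IsUnramifiedAt v)
    (hlamvbar : lam.IsUnramifiedAt vbar) (hprim : ∀ w ∈ S, ¬ lam.IsUnramifiedAt w)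
    (hunr : ∀ w : HeightOneSpectrum (𝓞 K), w ∉ S → w ≠ v → w ≠ vbar → lam.IsUnramifiedAt w)
    {κ₁ κ₂ : ZpExtension K p} {γ₁ γ₂ : absoluteGaloisGroup K}
    (hγ : ZpExtension.IsUnitGeneratorPair κ₁ κ₂ γ₁ γ₂)
    {G : PowerSeries (PowerSeries (PadicComplexInt p))}
    (hG : IsKatzMeasure₂ ι v vbar S κ₁ κ₂ γ₁ γ₂ lam Ω δ ((Ωp : unrIntegers p) : ℂ_[p]) G)
    {Gc : PowerSeries (PowerSeries (PadicComplexInt p))}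
    (hGc : IsKatzMeasure₂ ι v vbar (S.image fun w ↦ IsCMField.complexConj K • w) κ₁ κ₂ γ₁ γ₂
      (reflect lam) Ω δ ((Ωp : unrIntegers p) : ℂ_[p]) Gc) :
    ∃ (C : ℂ_[p]) (g : absoluteGaloisGroup K), ‖C‖ = 1 ∧
      ∀ (r r₂ : FramedGaloisRep K (PadicAlgCl p) 1),
        FactorsThroughPair κ₁ κ₂ r → FactorsThroughPair κ₁ κ₂ r₂ → IsConjInverse r r₂ →
        ∀ x : ℂ_[p],
          IntSeries.HasValueAt₂ Gc (avatarValueAt r₂ γ₁ - 1) (avatarValueAt r₂ γ₂ - 1) x →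
          IntSeries.HasValueAt₂ G (avatarValueAt r γ₁ - 1) (avatarValueAt r γ₂ - 1)
            (C * avatarValueAt r g * x) := by
  obtain ⟨Gc₀, C, g, hGc₀, hC, hrel⟩ := hF p K hK ι v vbar hv hvbar hne hι Ω δ Ωp hΩ hδ S hvS hvbS
    lam hlam hlamv hlamvbar hprim hunr κ₁ κ₂ γ₁ γ₂ hγ G hG
  have hlamS : ∀ w : HeightOneSpectrum (𝓞 K), w ∉ S → lam.IsUnramifiedAt w := by
    intro w hw
    by_cases hwv : w = v
    · rw [hwv]; exact hlamv
    by_cases hwvb : w = vbar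
    · rw [hwvb]; exact hlamvbar
    exact hunr w hw hwv hwvb
  have heq : Gc₀ = Gc := isKatzMeasure₂_reflect_unique hK hv hvbar hne hι hlam hlamS hγ hGc₀ hGc
  subst heq
  exact ⟨C, g, hC, hrel⟩

/-- **∀G ⟸ ∃G AT FIXED DATA — the functional equation for EVERY frame from the functional equation for ONE
frame, at the same `(ι, v, v̄, S, λ, κ₁, κ₂, γ₁, γ₂, Ω, δ, Ω_p)`** (every `p`): if SOME `λ`-frame `G₀` satisfies the
relation of `thmII64_katzMeasure₂_functionalEquation` with some `λ̌`-frame `Ǧ`, unit `C` and `g`, then EVERY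
`λ`-frame `G` does (`G = G₀`, `isKatzMeasure₂_unique_of_isAlgebraic`). The ∃-shaped statement is de Shalit's
II.6.4 (i) for THE measure written in the coordinates `(κ₁, κ₂; γ₁, γ₂)` at the normalisation `(Ω, δ, Ω_p)`; what
this certificate does NOT transport is the period triple and the generator pair (two-variable period rigidity,
`PrintCf2.KatzPeriodRigidity.exists_eq_unit_binomPow₂_mul`, and a `GL₂(ℤ_p)` change of variables).
[cite: deShalit1987, II.6.4 Theorem (i) (9), (14)–(15) (store chunk 84–85), II.4.17 (54) (store chunk 78)] -/
theorem thmII64_conclusion_of_exists_frame_at_fixed_data [IsCMField K] (hK : IsImaginaryQuadratic K)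
    {ι : PadicAlgCl p ≃+* ℂ} {v vbar : HeightOneSpectrum (𝓞 K)}
    (hv : ((p : ℕ) : 𝓞 K) ∈ v.asIdeal) (hvbar : ((p : ℕ) : 𝓞 K) ∈ vbar.asIdeal) (hne : vbar ≠ v)
    (hι : ∀ (w : InfinitePlace K) (k : 𝓞 K), k ∈ v.asIdeal ↔ ‖ι.symm (w.embedding (k : K))‖ < 1)
    {S : Finset (HeightOneSpectrum (𝓞 K))}
    {lam : HeckeCharacter K} (hlam : lam.IsAlgebraic)
    (hlamu : ∀ w : HeightOneSpectrum (𝓞 K), w ∉ S → w ≠ vbar → lam.IsUnramifiedAt w)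
    {κ₁ κ₂ : ZpExtension K p} {γ₁ γ₂ : absoluteGaloisGroup K}
    (hγ : ZpExtension.IsUnitGeneratorPair κ₁ κ₂ γ₁ γ₂) {Ω δ : ℂ} {Ωp : ℂ_[p]}
    (hex : ∃ (G₀ Gc : PowerSeries (PowerSeries (PadicComplexInt p))) (C : ℂ_[p]) (g : absoluteGaloisGroup K),
      IsKatzMeasure₂ ι v vbar S κ₁ κ₂ γ₁ γ₂ lam Ω δ Ωp G₀ ∧
      IsKatzMeasure₂ ι v vbar (S.image fun w ↦ IsCMField.complexConj K • w) κ₁ κ₂ γ₁ γ₂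
          (reflect lam) Ω δ Ωp Gc ∧
      ‖C‖ = 1 ∧
      ∀ (r r₂ : FramedGaloisRep K (PadicAlgCl p) 1),
        FactorsThroughPair κ₁ κ₂ r → FactorsThroughPair κ₁ κ₂ r₂ → IsConjInverse r r₂ →
        ∀ x : ℂ_[p],
          IntSeries.HasValueAt₂ Gc (avatarValueAt r₂ γ₁ - 1) (avatarValueAt r₂ γ₂ - 1) x →
          IntSeries.HasValueAt₂ G₀ (avatarValueAt r γ₁ - 1) (avatarValueAt r γ₂ - 1)
            (C * avatarValueAt r g * x))
    {G : PowerSeries (PowerSeries (PadicComplexInt p))}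
    (hG : IsKatzMeasure₂ ι v vbar S κ₁ κ₂ γ₁ γ₂ lam Ω δ Ωp G) :
    ∃ (Gc : PowerSeries (PowerSeries (PadicComplexInt p))) (C : ℂ_[p]) (g : absoluteGaloisGroup K),
      IsKatzMeasure₂ ι v vbar (S.image fun w ↦ IsCMField.complexConj K • w) κ₁ κ₂ γ₁ γ₂
          (reflect lam) Ω δ Ωp Gc ∧
      ‖C‖ = 1 ∧
      ∀ (r r₂ : FramedGaloisRep K (PadicAlgCl p) 1),
        FactorsThroughPair κ₁ κ₂ r → FactorsThroughPair κ₁ κ₂ r₂ → IsConjInverse r r₂ →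
        ∀ x : ℂ_[p],
          IntSeries.HasValueAt₂ Gc (avatarValueAt r₂ γ₁ - 1) (avatarValueAt r₂ γ₂ - 1) x →
          IntSeries.HasValueAt₂ G (avatarValueAt r γ₁ - 1) (avatarValueAt r γ₂ - 1)
            (C * avatarValueAt r g * x) := by
  obtain ⟨G₀, Gc, C, g, hG₀, hGc, hC, hrel⟩ := hex
  have heq : G₀ = G := isKatzMeasure₂_unique_of_isAlgebraic hK hv hvbar hne hι hlam hlamu hγ hG₀ hG
  subst heq
  exact ⟨Gc, C, g, hGc, hC, hrel⟩

/-! ### §5 Two-variable PERIOD rigidity (λ-side) for every class number and UNIT generator pairs -/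

/-- **FULL TWO-VARIABLE PERIOD RIGIDITY, seedless and for UNIT generator pairs** (`λ` of type `(−a, b)`, `b ≤ a`, as in
`PrintCf2.KatzPeriodRigidity.exists_eq_unit_binomPow₂_mul`; the type-`(w₀,0)` seed is the tree's any-class-number one, the unit pair
is reduced to a top pair by `ZpExtension.unitTwist`): two frames `G ≠ 0` at `(Ω, δ, Ω_p)` and `G'` at `(Ω', δ', Ω_p')` of ONE branch
differ by the unit `C₀·(1+T₁)^x·(1+T₂)^w`, `C₀ = A^{a+b}B^b`. For the cell: `λ = θ_K⁻¹` (`a = b = 0`) at Rubin's INVERSE generators on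
any imaginary quadratic `K`. [cite: deShalit1987, II.4.12 Remarks (iii)–(iv) (p. 66–67), II.4.17 (52)–(54) (p. 77–78)] -/
theorem exists_eq_unit_binomPow₂_mul_of_isUnitGeneratorPair (hK : IsImaginaryQuadratic K)
    {ι : PadicAlgCl p ≃+* ℂ} {v vbar : HeightOneSpectrum (𝓞 K)}
    (hv : ((p : ℕ) : 𝓞 K) ∈ v.asIdeal) (hvbar : ((p : ℕ) : 𝓞 K) ∈ vbar.asIdeal) (hne : vbar ≠ v)
    (hι : ∀ (w : InfinitePlace K) (d : 𝓞 K), d ∈ v.asIdeal ↔ ‖ι.symm (w.embedding (d : K))‖ < 1)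
    {S : Finset (HeightOneSpectrum (𝓞 K))}
    {lam : HeckeCharacter K} {a b : ℕ} (hba : b ≤ a)
    (hlam : lam.HasInfinityType (fun _ ↦ -(a : ℤ)) (fun _ ↦ (b : ℤ)))
    (hlamu : ∀ w : HeightOneSpectrum (𝓞 K), w ∉ S → w ≠ vbar → lam.IsUnramifiedAt w)
    {κ₁ κ₂ : ZpExtension K p} {γ₁ γ₂ : absoluteGaloisGroup K}
    (hpair : ZpExtension.IsUnitGeneratorPair κ₁ κ₂ γ₁ γ₂)
    {Ω δ Ω' δ' : ℂ} {Ωp Ωp' : ℂ_[p]} {G G' : PowerSeries (PowerSeries (PadicComplexInt p))}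
    (hG : IsKatzMeasure₂ ι v vbar S κ₁ κ₂ γ₁ γ₂ lam Ω δ Ωp G)
    (hG' : IsKatzMeasure₂ ι v vbar S κ₁ κ₂ γ₁ γ₂ lam Ω' δ' Ωp' G')
    (hΩ : Ω ≠ 0) (hδ : δ ≠ 0) (hΩp : Ωp ≠ 0) (hΩ' : Ω' ≠ 0) (hδ' : δ' ≠ 0) (hΩp' : Ωp' ≠ 0)
    (hG0 : G ≠ 0) :
    ∃ (c₀ : PadicComplexInt p) (x w : ℤ_[p]), IsUnit c₀ ∧
      (c₀ : ℂ_[p]) = ((((ι.symm (Ω / Ω')) : PadicAlgCl p) : ℂ_[p]) * (Ωp' / Ωp)) ^ (a + b) *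
        (((ι.symm (δ / δ')) : PadicAlgCl p) : ℂ_[p]) ^ b ∧
      G' = PowerSeries.C (PowerSeries.C c₀) *
        (PowerSeries.map (PowerSeries.C (R := PadicComplexInt p)) (IntSeries.binomPow x) *
          PowerSeries.C (IntSeries.binomPow w)) * G := by
  haveI : IsTotallyComplex K := hK.2
  obtain ⟨w₀, η, hw₀, hη, -⟩ :=
    Literature.NumberTheory.GaloisRepresentations.HeckeCharacter.exists_hasInfinityType_pos_zero_unramified
      (K := K) hK.1
  obtain ⟨u₁, u₂, htop⟩ := exists_isTopGeneratorPair_unitTwist hpair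
  exact PrintCf2.KatzPeriodRigidity.exists_eq_unit_binomPow₂_mul hK hv hvbar hne hι hw₀ hη hba hlam hlamu htop
    ((PrintCf2.KatzUniqueTransport.isKatzMeasure₂_unitTwist_iff κ₁ κ₂ u₁ u₂).mpr hG) ((PrintCf2.KatzUniqueTransport.isKatzMeasure₂_unitTwist_iff κ₁ κ₂ u₁ u₂).mpr hG')
    hΩ hδ hΩp hΩ' hδ' hΩp' hG0

/-- **IDEAL RIGIDITY, seedless and for unit generator pairs**: two frames of one branch (`λ` of type `(−a,b)`, `b ≤ a`) at two
period triples generate the SAME ideal of `𝒪_{ℂ_p}⟦T₁⟧⟦T₂⟧` — every imaginary quadratic `K`.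
[cite: deShalit1987, II.4.12 Remarks (iii)–(iv) (p. 66–67)] -/
theorem span_eq_span_of_isKatzMeasure₂_of_isUnitGeneratorPair (hK : IsImaginaryQuadratic K)
    {ι : PadicAlgCl p ≃+* ℂ} {v vbar : HeightOneSpectrum (𝓞 K)}
    (hv : ((p : ℕ) : 𝓞 K) ∈ v.asIdeal) (hvbar : ((p : ℕ) : 𝓞 K) ∈ vbar.asIdeal) (hne : vbar ≠ v)
    (hι : ∀ (w : InfinitePlace K) (d : 𝓞 K), d ∈ v.asIdeal ↔ ‖ι.symm (w.embedding (d : K))‖ < 1)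
    {S : Finset (HeightOneSpectrum (𝓞 K))}
    {lam : HeckeCharacter K} {a b : ℕ} (hba : b ≤ a)
    (hlam : lam.HasInfinityType (fun _ ↦ -(a : ℤ)) (fun _ ↦ (b : ℤ)))
    (hlamu : ∀ w : HeightOneSpectrum (𝓞 K), w ∉ S → w ≠ vbar → lam.IsUnramifiedAt w)
    {κ₁ κ₂ : ZpExtension K p} {γ₁ γ₂ : absoluteGaloisGroup K}
    (hpair : ZpExtension.IsUnitGeneratorPair κ₁ κ₂ γ₁ γ₂)
    {Ω δ Ω' δ' : ℂ} {Ωp Ωp' : ℂ_[p]} {G G' : PowerSeries (PowerSeries (PadicComplexInt p))}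
    (hG : IsKatzMeasure₂ ι v vbar S κ₁ κ₂ γ₁ γ₂ lam Ω δ Ωp G)
    (hG' : IsKatzMeasure₂ ι v vbar S κ₁ κ₂ γ₁ γ₂ lam Ω' δ' Ωp' G')
    (hΩ : Ω ≠ 0) (hδ : δ ≠ 0) (hΩp : Ωp ≠ 0) (hΩ' : Ω' ≠ 0) (hδ' : δ' ≠ 0) (hΩp' : Ωp' ≠ 0)
    (hG0 : G ≠ 0) :
    Ideal.span {G'} = Ideal.span {G} := by
  obtain ⟨c₀, x, w, hc₀, -, hGG⟩ := exists_eq_unit_binomPow₂_mul_of_isUnitGeneratorPair hK hv hvbar hne hι hba hlam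
    hlamu hpair hG hG' hΩ hδ hΩp hΩ' hδ' hΩp' hG0
  have hU : IsUnit (PowerSeries.C (PowerSeries.C c₀) *
      (PowerSeries.map (PowerSeries.C (R := PadicComplexInt p)) (IntSeries.binomPow x) *
        PowerSeries.C (IntSeries.binomPow w))) :=
    ((hc₀.map PowerSeries.C).map PowerSeries.C).mul
      (((IntSeries.isUnit_binomPow x).map _).mul ((IntSeries.isUnit_binomPow w).map _))
  rw [hGG]
  exact Ideal.span_singleton_mul_left_unit hU G

end Summit.BirchSwinnertonDyer.BirchSwinnertonDyer.Theorems.GoodLatticeKatzMeasureUniquenessBinders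

end
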